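import Mathlib
import Literature.Combinatorics.Optimization.ApproximateConicalJuntas
import Literature.Combinatorics.Optimization.LpFormulationReductions
import Literature.Computability.AlgebraicComplexity.RankMethodBarriers
import HarnessLib

/-!
# Kothari–Meka–Raghavendra 2017, eq. (1.2): the non-negative rank of a pattern matrix is at most
# `binom(n, deg_+ f) · 2^{b · deg_+ f}`, and its rank is at most `binom(n, deg f) · 2^{b · deg f}` — PROVED

Source: P. K. Kothari, R. Meka, P. Raghavendra, *Approximating rectangles by juntas and weakly-exponential
lower bounds for LP relaxations of CSPs*, STOC 2017 / SIAM J. Comput. 51 (2022) = arXiv:1610.02704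
[KothariMekaRaghavendra2017]; held text `paper:arxiv-1610.02704` (§1.2, p. 5 and §7, p. 21 read first-hand
2026-08-28; locators "p. N" = pages of that rendering, as in `LPRelaxationsMaxCSP.lean`).

Printed statements (verbatim up to notation) and how they are rendered:

* §1.2, eq. (1.2) (p. 5): "We show that for any non-negative function `f`, the non-negative rank of `M_f`
  is essentially characterized by the non-negative degree of `f`. Indeed, it is easy to check that
  `nnr(M^b_f) ≤ binom(n, deg_+(f)) · 2^{b · deg_+(f)}`."  — `KothariMekaRaghavendra2017_eq12`
  (`f ≥ 0` explicit: the tree's `nonnegDegree` is an infimum over `ℕ`, and `deg_+` is only meaningful for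
  `f ≥ 0`, Def. 1.8/1.9 p. 4; "`nnr(M) ≤ X`" reads `HasNonnegFactorization M X`, Def. 1.6).
* ibid., after Theorem 1.10 (p. 5): "Note that by (1.2), for `b > log n`, `nnr(M^b_f) ≤ 2^{2b · deg_+(f)}`.
  Thus in the interesting regime when `deg_+(f) ≫ deg(f)`, the above theorem is tight up to constant
  factors (in the exponent) and working with `deg_+(f+η)`."  — `KothariMekaRaghavendra2017_eq12_log`, typed
  with the hypothesis in the form the one-line estimate `binom(n,d) ≤ n^d ≤ 2^{bd}` uses, `n ≤ 2^b`
  (implied by the printed `b > log₂ n`).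
* §7, proof of Theorem 1.11 (p. 21): "Then, for all `b`, `rank(M_f^b) ≤ binom(n, deg(f)) · 2^{b · deg(f)}`"
  — `KothariMekaRaghavendra2017_rank_le` (`Matrix.rank` of `Matrix.of (ipPatternMatrix b f)` over `ℝ`;
  `deg(f)` = the tree's `cubeDegree`).

No proof is printed ("it is easy to check").  The proof given here (elementary; recorded because the
tree's Theorem 1.10, `KothariMekaRaghavendra2017_thm110_holds`, is the matching LOWER bound): the pattern
matrix `M_g^b` of a function `g` reading only the coordinates in `S ⊆ [n]` factors through the restriction
`x ↦ x_S` of the ROW index — `M_g^b = U · V` with `U(x, a) = [x_S = a]` (`a ∈ ({0,1}^b)^S`) and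
`V(a, y) = M_g^b(ā, y)` for any extension `ā` of `a` — a factorization of inner dimension
`|({0,1}^b)^S| = 2^{b|S|}`, non-negative when `g ≥ 0`
(`hasNonnegFactorization_ipPatternMatrix_of_dependsOn`, `rank_ipPatternMatrix_of_dependsOn_le`).  A conical
`d`-junta (resp. a function of degree `≤ d`, written in the Walsh basis) with `d ≤ n` is a sum over the
`binom(n,d)` sets `T` of size exactly `d` of non-negative `T`-juntas (resp. of `T`-juntas): give every term
a `d`-element superset of its support (`Finset.exists_subsuperset_card_eq`) and group the terms by it
(`Finset.sum_fiberwise_of_maps_to`); non-negative rank and rank are subadditive (the tree's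
`HasNonnegFactorization.add` of `LpFormulationReductions.lean` and `matrix_rank_sum_le` of
`Literature/Computability/AlgebraicComplexity/RankMethodBarriers.lean`, reused; here `hasNonnegFactorization_sum`).

Vocabulary: all from `LPRelaxationsMaxCSP.lean` (`ipPatternMatrix`, `ipGadget`, `HasNonnegFactorization`,
`IsJunta`, `IsConicalJunta`, `nonnegDegree`, `cubeDegree`) and the cube Fourier dictionary (`walsh`,
`cubeFourierCoeff`, `sum_cubeFourierCoeff_mul_walsh`, `HasDegreeLE.cubeFourierCoeff_eq_zero`).  No new
notions, no named facts, no instances, no notation; standard axioms.  Label: literature formalization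
(row (5) of the literature-typing layer, cell pnp-psdrank); no P-vs-NP content.
-/

noncomputable section

open Finset Matrix
open Literature.Probability.RandomGraphs.LowDegree (walsh sgn)
open Literature.Computability.Complexity.LowDegree (cubeFourierCoeff sum_cubeFourierCoeff_mul_walsh)
open Literature.Computability.Complexity.ApproximateDegree (hasDegreeLE_card)
open Literature.Computability.AlgebraicComplexity (matrix_rank_sum_le)

namespace Literature.Combinatorics.Optimization

/-! ### Non-negative factorizations: reindexing, zero, sums, padding -/

section Factorizations

variable {ι κ : Type*}

/-- A non-negative factorization through any finite inner index type `α` is a non-negative factorization of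
size `|α|` (Def. 1.6 counts rank-one summands; their indexing is immaterial).
[cite: KothariMekaRaghavendra2017, Def. 1.6 (p. 4)] -/
theorem hasNonnegFactorization_of_fintype {α : Type*} [Fintype α] {M : ι → κ → ℝ} (U : ι → α → ℝ)
    (V : α → κ → ℝ) (hU : ∀ i a, 0 ≤ U i a) (hV : ∀ a j, 0 ≤ V a j)
    (hM : ∀ i j, M i j = ∑ a, U i a * V a j) : HasNonnegFactorization M (Fintype.card α) := by
  classical
  refine ⟨fun i l => U i ((Fintype.equivFin α).symm l), fun l j => V ((Fintype.equivFin α).symm l) j,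
    fun i l => hU _ _, fun l j => hV _ _, fun i j => ?_⟩
  rw [hM i j]
  exact ((Fintype.equivFin α).symm.sum_comp (fun a => U i a * V a j)).symm

/-- The zero matrix has a non-negative factorization of every size. [cite: KothariMekaRaghavendra2017, Def. 1.6 (p. 4)] -/
theorem hasNonnegFactorization_zero (s : ℕ) : HasNonnegFactorization (fun (_ : ι) (_ : κ) => (0 : ℝ)) s :=
  ⟨fun _ _ => 0, fun _ _ => 0, fun _ _ => le_rfl, fun _ _ => le_rfl, fun _ _ => by simp⟩

/-- Padding: a non-negative factorization of size `r` is one of every size `s ≥ r`.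
[cite: KothariMekaRaghavendra2017, Def. 1.6 (p. 4: "the least positive integer r")] -/
theorem HasNonnegFactorization.mono {M : ι → κ → ℝ} {r s : ℕ} (hM : HasNonnegFactorization M r)
    (hrs : r ≤ s) : HasNonnegFactorization M s := by
  have h := hM.add (hasNonnegFactorization_zero (ι := ι) (κ := κ) (s - r))
  simp only [add_zero] at h
  rw [Nat.add_sub_cancel' hrs] at h
  exact h

/-- **Subadditivity over a finite sum:** if every `M_t`, `t ∈ s`, has `nnr ≤ r`, then `Σ_{t ∈ s} M_t` has
`nnr ≤ |s| · r`. [cite: KothariMekaRaghavendra2017, Def. 1.6 (p. 4)] -/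
theorem hasNonnegFactorization_sum {β : Type*} (s : Finset β) {M : β → ι → κ → ℝ} {r : ℕ}
    (h : ∀ t ∈ s, HasNonnegFactorization (M t) r) :
    HasNonnegFactorization (fun i j => ∑ t ∈ s, M t i j) (s.card * r) := by
  classical
  induction s using Finset.induction_on with
  | empty => simpa using hasNonnegFactorization_zero (ι := ι) (κ := κ) 0
  | insert a s ha ih =>
    have h1 := (h a (mem_insert_self a s)).add (ih fun t ht => h t (mem_insert_of_mem ht))
    rw [card_insert_of_notMem ha, add_mul, one_mul, add_comm (s.card * r) r]
    simpa only [sum_insert ha] using h1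

end Factorizations

/-! ### The pattern matrix of a junta factors through the restriction of the row index -/

section Junta

variable {n : ℕ} (b : ℕ)

/-- Rows of `M_g^b` indexed by `x, x'` that agree on the coordinates `g` reads are equal.
[cite: KothariMekaRaghavendra2017, Def. 1.7 (p. 4) with eq. (1.2) (p. 5)] -/
theorem ipPatternMatrix_congr_left {S : Finset (Fin n)} {g : (Fin n → Bool) → ℝ}
    (hg : ∀ z z' : Fin n → Bool, (∀ i ∈ S, z i = z' i) → g z = g z')
    {x x' : Fin n → Fin b → Bool} (hx : ∀ i ∈ S, x i = x' i) (y : Fin n → Fin b → Bool) :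
    ipPatternMatrix b g x y = ipPatternMatrix b g x' y :=
  hg _ _ fun i hi => by simp only [hx i hi]

/-- A Walsh character `χ_S` reads only the coordinates in `S`. [cite: KothariMekaRaghavendra2017, §7 (p. 21)] -/
theorem walsh_congr {S : Finset (Fin n)} {z z' : Fin n → Bool} (h : ∀ i ∈ S, z i = z' i) :
    walsh S z = walsh S z' := by
  unfold Literature.Probability.RandomGraphs.LowDegree.walsh
  exact prod_congr rfl fun i hi => by rw [h i hi]

/-- **The junta factorization (non-negative form).**  If `g ≥ 0` reads only the coordinates in `S`, then
`nnr(M_g^b) ≤ 2^{b|S|}`: `M_g^b(x, y) = Σ_{a ∈ ({0,1}^b)^S} [x_S = a] · M_g^b(ā, y)`.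
[cite: KothariMekaRaghavendra2017, eq. (1.2) (p. 5)] -/
theorem hasNonnegFactorization_ipPatternMatrix_of_dependsOn (S : Finset (Fin n))
    {g : (Fin n → Bool) → ℝ} (hg : ∀ z z' : Fin n → Bool, (∀ i ∈ S, z i = z' i) → g z = g z')
    (hg0 : ∀ z, 0 ≤ g z) : HasNonnegFactorization (ipPatternMatrix b g) (2 ^ (b * S.card)) := by
  classical
  -- extension of a partial row index by all-`false` blocks, and restriction to `S`
  let ext : (S → Fin b → Bool) → (Fin n → Fin b → Bool) :=
    fun a i => if h : i ∈ S then a ⟨i, h⟩ else fun _ => false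
  let res : (Fin n → Fin b → Bool) → (S → Fin b → Bool) := fun x i => x i
  have hres : ∀ x : Fin n → Fin b → Bool, ∀ i ∈ S, ext (res x) i = x i := by
    intro x i hi; simp [ext, res, hi]
  have hcard : Fintype.card (S → Fin b → Bool) = 2 ^ (b * S.card) := by
    simp [pow_mul]
  have hsum : ∀ x y : Fin n → Fin b → Bool, ipPatternMatrix b g x y =
      ∑ a : S → Fin b → Bool, (if res x = a then (1 : ℝ) else 0) * ipPatternMatrix b g (ext a) y := by
    intro x y
    rw [Finset.sum_eq_single (res x)]
    · rw [if_pos rfl, one_mul]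
      exact ipPatternMatrix_congr_left b hg (fun i hi => (hres x i hi).symm) y
    · intro a _ ha; rw [if_neg (Ne.symm ha), zero_mul]
    · intro h; exact absurd (mem_univ _) h
  have h := hasNonnegFactorization_of_fintype (M := ipPatternMatrix b g)
    (fun x a => if res x = a then (1 : ℝ) else 0) (fun a y => ipPatternMatrix b g (ext a) y)
    (fun x a => by split_ifs <;> norm_num) (fun a y => hg0 _) hsum
  rwa [hcard] at h

/-- **The junta factorization (rank form).**  If `g` reads only the coordinates in `S`, then
`rank(M_g^b) ≤ 2^{b|S|}`. [cite: KothariMekaRaghavendra2017, §7 (p. 21) with eq. (1.2) (p. 5)] -/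
theorem rank_ipPatternMatrix_of_dependsOn_le (S : Finset (Fin n)) {g : (Fin n → Bool) → ℝ}
    (hg : ∀ z z' : Fin n → Bool, (∀ i ∈ S, z i = z' i) → g z = g z') :
    (Matrix.of (ipPatternMatrix b g)).rank ≤ 2 ^ (b * S.card) := by
  classical
  let ext : (S → Fin b → Bool) → (Fin n → Fin b → Bool) :=
    fun a i => if h : i ∈ S then a ⟨i, h⟩ else fun _ => false
  let res : (Fin n → Fin b → Bool) → (S → Fin b → Bool) := fun x i => x i
  have hres : ∀ x : Fin n → Fin b → Bool, ∀ i ∈ S, ext (res x) i = x i := by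
    intro x i hi; simp [ext, res, hi]
  have hcard : Fintype.card (S → Fin b → Bool) = 2 ^ (b * S.card) := by
    simp [pow_mul]
  let U : Matrix (Fin n → Fin b → Bool) (S → Fin b → Bool) ℝ :=
    Matrix.of fun x a => if res x = a then (1 : ℝ) else 0
  let V : Matrix (S → Fin b → Bool) (Fin n → Fin b → Bool) ℝ :=
    Matrix.of fun a y => ipPatternMatrix b g (ext a) y
  have hUV : Matrix.of (ipPatternMatrix b g) = U * V := by
    ext x y
    rw [Matrix.mul_apply, Matrix.of_apply, Finset.sum_eq_single (res x)]
    · have hU1 : U x (res x) = 1 := if_pos rfl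
      rw [hU1, one_mul]
      exact ipPatternMatrix_congr_left b hg (fun i hi => (hres x i hi).symm) y
    · intro a _ ha
      have hU0 : U x a = 0 := if_neg (Ne.symm ha)
      rw [hU0, zero_mul]
    · intro h; exact absurd (mem_univ _) h
  rw [hUV]
  calc (U * V).rank ≤ U.rank := Matrix.rank_mul_le_left U V
    _ ≤ Fintype.card (S → Fin b → Bool) := Matrix.rank_le_card_width U
    _ = 2 ^ (b * S.card) := hcard

end Junta

/-! ### eq. (1.2): conical `d`-juntas and functions of degree `≤ d` -/

section Eq12

variable {n : ℕ} (b : ℕ)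

/-- **Conical `d`-juntas have pattern matrices of non-negative rank `≤ binom(n,d) · 2^{bd}`** (`d ≤ n`):
group the non-negative juntas of a conical combination by a `d`-element superset of their supports.
[cite: KothariMekaRaghavendra2017, eq. (1.2) (p. 5)] -/
theorem hasNonnegFactorization_ipPatternMatrix_of_isConicalJunta {d : ℕ} (hd : d ≤ n)
    {f : (Fin n → Bool) → ℝ} (hf : IsConicalJunta d f) :
    HasNonnegFactorization (ipPatternMatrix b f) (n.choose d * 2 ^ (b * d)) := by
  classical
  obtain ⟨t, lam, h, hlam, hjun, hh0, hf⟩ := hf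
  have hjun' : ∀ i, ∃ S : Finset (Fin n), S.card ≤ d ∧
      ∀ x y : Fin n → Bool, (∀ j ∈ S, x j = y j) → h i x = h i y := hjun
  choose S hS using hjun'
  have hpad : ∀ i, ∃ T : Finset (Fin n), S i ⊆ T ∧ T.card = d := fun i => by
    obtain ⟨T, hST, -, hT⟩ :=
      Finset.exists_subsuperset_card_eq (subset_univ (S i)) (hS i).1 (by simpa using hd)
    exact ⟨T, hST, hT⟩
  choose T hT using hpad
  set P : Finset (Finset (Fin n)) := (univ : Finset (Fin n)).powersetCard d with hP
  have hTP : ∀ i ∈ (univ : Finset (Fin t)), T i ∈ P := fun i _ => by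
    simp [hP, mem_powersetCard, (hT i).2]
  -- group the terms by their padded support
  let g : Finset (Fin n) → (Fin n → Bool) → ℝ :=
    fun R z => ∑ i ∈ univ.filter (fun i => T i = R), lam i * h i z
  have hfg : ∀ z, f z = ∑ R ∈ P, g R z := fun z => by
    rw [hf z]; exact (Finset.sum_fiberwise_of_maps_to hTP _).symm
  have hg0 : ∀ R z, 0 ≤ g R z := fun R z => sum_nonneg fun i _ => mul_nonneg (hlam i) (hh0 i z)
  have hgdep : ∀ R : Finset (Fin n), ∀ z z' : Fin n → Bool, (∀ j ∈ R, z j = z' j) →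
      g R z = g R z' := by
    intro R z z' hzz'
    refine sum_congr rfl fun i hi => ?_
    have hTi : T i = R := (mem_filter.1 hi).2
    rw [(hS i).2 z z' fun j hj => hzz' j (hTi ▸ (hT i).1 hj)]
  have hfac : ∀ R ∈ P, HasNonnegFactorization (ipPatternMatrix b (g R)) (2 ^ (b * d)) := by
    intro R hR
    have hRd : R.card = d := (mem_powersetCard.1 hR).2
    rw [← hRd]
    exact hasNonnegFactorization_ipPatternMatrix_of_dependsOn b R (hgdep R) (hg0 R)
  have hsum := hasNonnegFactorization_sum P hfac
  rw [card_powersetCard, card_univ, Fintype.card_fin] at hsum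
  have hM : ipPatternMatrix b f = fun x y => ∑ R ∈ P, ipPatternMatrix b (g R) x y := by
    funext x y; simp only [ipPatternMatrix]; exact hfg _
  rw [hM]
  exact hsum

/-- **Kothari–Meka–Raghavendra 2017, eq. (1.2) — PROVED.**  For every `f : {0,1}ⁿ → ℝ_{≥0}` and every
block length `b`: `nnr(M_f^b) ≤ binom(n, deg_+(f)) · 2^{b · deg_+(f)}`, i.e. the pattern matrix `M_f^b`
has a non-negative factorization of that size.  (The matching lower bound
`nnr(M_f^b) ≥ 2^{c b (deg_+(f+η) − 8 deg f)}` is Theorem 1.10, `KothariMekaRaghavendra2017_thm110_holds`.)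
[cite: KothariMekaRaghavendra2017, eq. (1.2) (p. 5)] -/
theorem KothariMekaRaghavendra2017_eq12 {f : (Fin n → Bool) → ℝ} (hf : ∀ z, 0 ≤ f z) (b : ℕ) :
    HasNonnegFactorization (ipPatternMatrix b f)
      (n.choose (nonnegDegree f) * 2 ^ (b * nonnegDegree f)) :=
  hasNonnegFactorization_ipPatternMatrix_of_isConicalJunta b (nonnegDegree_le f)
    (isConicalJunta_nonnegDegree hf)

/-- **The remark after Theorem 1.10 — PROVED:** "for `b > log n`, `nnr(M_f^b) ≤ 2^{2b · deg_+(f)}`"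
(`binom(n,d) ≤ n^d ≤ 2^{bd}` once `n ≤ 2^b`), the sense in which Theorem 1.10 is tight up to the constant
in the exponent. [cite: KothariMekaRaghavendra2017, Thm 1.10, remark following it (p. 5)] -/
theorem KothariMekaRaghavendra2017_eq12_log {f : (Fin n → Bool) → ℝ} (hf : ∀ z, 0 ≤ f z) {b : ℕ}
    (hb : n ≤ 2 ^ b) : HasNonnegFactorization (ipPatternMatrix b f) (2 ^ (2 * b * nonnegDegree f)) := by
  refine (KothariMekaRaghavendra2017_eq12 hf b).mono ?_
  set d := nonnegDegree f
  calc n.choose d * 2 ^ (b * d) ≤ n ^ d * 2 ^ (b * d) :=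
        Nat.mul_le_mul_right _ (Nat.choose_le_pow n d)
    _ ≤ (2 ^ b) ^ d * 2 ^ (b * d) := Nat.mul_le_mul_right _ (Nat.pow_le_pow_left hb d)
    _ = 2 ^ (2 * b * d) := by rw [← pow_mul, ← pow_add]; ring_nf

/-- **Functions of degree `≤ d` have pattern matrices of rank `≤ binom(n,d) · 2^{bd}`** (`d ≤ n`): write
`f` in the Walsh basis and group the characters `χ_S`, `|S| ≤ d`, by a `d`-element superset of `S`.
[cite: KothariMekaRaghavendra2017, §7 (p. 21: "for all b, rank(M_f^b) ≤ binom(n, deg f) · 2^{b deg f}")] -/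
theorem rank_ipPatternMatrix_le_of_hasDegreeLE {d : ℕ} (hd : d ≤ n) {f : (Fin n → Bool) → ℝ}
    (hf : HasDegreeLE d f) :
    (Matrix.of (ipPatternMatrix b f)).rank ≤ n.choose d * 2 ^ (b * d) := by
  classical
  have hpad : ∀ S : Finset (Fin n), S.card ≤ d → ∃ T : Finset (Fin n), S ⊆ T ∧ T.card = d :=
    fun S hS => by
      obtain ⟨T, hST, -, hT⟩ := Finset.exists_subsuperset_card_eq (subset_univ S) hS (by simpa using hd)
      exact ⟨T, hST, hT⟩
  choose T hT using hpad
  -- every Walsh character gets a `d`-set; those above level `d` (coefficient `0`) an arbitrary one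
  let τ : Finset (Fin n) → Finset (Fin n) :=
    fun S => if h : S.card ≤ d then T S h else T ∅ (by simp)
  set P : Finset (Finset (Fin n)) := (univ : Finset (Fin n)).powersetCard d with hP
  have hτP : ∀ S ∈ (univ : Finset (Finset (Fin n))), τ S ∈ P := by
    intro S _
    by_cases h : S.card ≤ d
    · simp [τ, h, hP, mem_powersetCard, (hT S h).2]
    · simp [τ, h, hP, mem_powersetCard, (hT ∅ (by simp)).2]
  let g : Finset (Fin n) → (Fin n → Bool) → ℝ :=
    fun R z => ∑ S ∈ univ.filter (fun S => τ S = R), cubeFourierCoeff f S * walsh S z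
  have hfg : ∀ z, f z = ∑ R ∈ P, g R z := fun z => by
    rw [← sum_cubeFourierCoeff_mul_walsh f z]
    exact (Finset.sum_fiberwise_of_maps_to hτP _).symm
  have hgdep : ∀ R : Finset (Fin n), ∀ z z' : Fin n → Bool, (∀ j ∈ R, z j = z' j) →
      g R z = g R z' := by
    intro R z z' hzz'
    refine sum_congr rfl fun S hS => ?_
    have hSR : τ S = R := (mem_filter.1 hS).2
    by_cases hSd : S.card ≤ d
    · have hsub : S ⊆ R := by
        rw [← hSR]; simp only [τ, dif_pos hSd]; exact (hT S hSd).1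
      rw [walsh_congr fun i hi => hzz' i (hsub hi)]
    · rw [hf.cubeFourierCoeff_eq_zero (not_le.1 hSd), zero_mul, zero_mul]
  have hrk : ∀ R ∈ P, (Matrix.of (ipPatternMatrix b (g R))).rank ≤ 2 ^ (b * d) := by
    intro R hR
    have hRd : R.card = d := (mem_powersetCard.1 hR).2
    rw [← hRd]
    exact rank_ipPatternMatrix_of_dependsOn_le b R (hgdep R)
  have hM : Matrix.of (ipPatternMatrix b f) = ∑ R ∈ P, Matrix.of (ipPatternMatrix b (g R)) := by
    ext x y
    simp only [Matrix.of_apply, Matrix.sum_apply, ipPatternMatrix]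
    exact hfg _
  rw [hM]
  calc (∑ R ∈ P, Matrix.of (ipPatternMatrix b (g R))).rank
      ≤ ∑ R ∈ P, (Matrix.of (ipPatternMatrix b (g R))).rank := matrix_rank_sum_le P _
    _ ≤ ∑ R ∈ P, 2 ^ (b * d) := sum_le_sum hrk
    _ = n.choose d * 2 ^ (b * d) := by
        rw [sum_const, smul_eq_mul, hP, card_powersetCard, card_univ, Fintype.card_fin]

/-- **Kothari–Meka–Raghavendra 2017, the rank bound of §7 — PROVED:** for all `b`,
`rank(M_f^b) ≤ binom(n, deg(f)) · 2^{b · deg(f)}`. [cite: KothariMekaRaghavendra2017, §7, proof of Thm 1.11 (p. 21)] -/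
theorem KothariMekaRaghavendra2017_rank_le (f : (Fin n → Bool) → ℝ) (b : ℕ) :
    (Matrix.of (ipPatternMatrix b f)).rank ≤ n.choose (cubeDegree f) * 2 ^ (b * cubeDegree f) :=
  rank_ipPatternMatrix_le_of_hasDegreeLE b ((cubeDegree_le_iff f n).2 (hasDegreeLE_card f))
    (hasDegreeLE_cubeDegree f)

end Eq12

end Literature.Combinatorics.Optimization

end
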